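import Literature.MathematicalPhysics.QuantumFieldTheory.Balaban1983to89.B9LettersHAtOneG0
import Literature.MathematicalPhysics.QuantumFieldTheory.Balaban1983to89.B9PerturbationLettersAtOne

/-!
# `Balaban1983to89.B9Letters313AtOneDir` — [B9] Thm 3.13's reduction letters AT THE TRIVIAL BACKGROUND, third batch: the DIRECTION-WISE
# `∇_νG₀Q*` letter `Letters313DM.dgQsd` (dag-n06-l's direction-indexed species) HOLDS AT `U = 1` at node00-def-Y's pinned letters, uniformly on
# the k-level census; and the perturbation letter `Letters313IMB.tDv` is inhabited at `U = 1` DEGENERATELY (`Δ′_π(1) + Δ⁽²⁾_π(1) = 0`)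

T. Bałaban, *Propagators for lattice gauge theories in a background field*, Commun. Math. Phys. **99** (1985) 389–434
[`Balaban1985BackgroundPropagators`, "B9"]; [4] = T. Bałaban, *Propagators and renormalization transformations for lattice gauge
theories. II*, Commun. Math. Phys. **96** (1984) 223–250 [`Balaban1984PropagatorsII`].

statement-level skeleton of published theorems with citation tags; proofs where landed; nothing here is a claim about the Yang–Mills
mass gap

THE PRINTED LOCI (verbatim).  [B9] p. 426 (Thm 3.13): *"The formulas (3.147), (3.153) permit us to reduce properties of the operators 𝔓, 𝔊 to
the corresponding properties of the operators G′, (Q′G′²Q′\*)⁻¹, G₁, (QG₁Q\*)⁻¹"*; p. 398 (after (3.47)): *"we may always replace ∇_U by ∇\*_U,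
and vice versa, in arbitrary place and combination"*; p. 407, before Cor. 3.5: *"There we have proved these theorems for operators with the
external gauge field configuration U = 1."*; p. 421, on Δ′_π at the trivial background the terms of (3.120) vanish (node00-def-Y
`deltaPiPrimeY_one`, `delta2PiY_one`).  [4] Prop. 2.6 (2.136) p. 247 (entry `|(∇GJ)(x)| ≤ O(1)Lʲη·e^{−δ₃d(y,y′)}|J|`), Lemma 2.1 (2.61) p. 234.

THE POINT.  dag-n06-d's N06 certificate (edition 19, `Summits/…/BalabanUVNodesN06AtOpsYNuOfRecordV6EPairMZ`) displays
`hlettersD13 : … → Letters313D … ∧ Letters313DM (𝔬12 x) (𝔭A x) (𝔡A x).Dd 1 (H x) … B12₃ Bq12 δ12₃ (bH13 x) U` and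
`hLIM : … → Letters313IMB (𝔬12 x) (𝔭A x) (𝔡A x).Dd (𝔡A x).Dsd 1 (H x) … U`, with the direction-indexed derivatives PINNED
(`h𝔡Ad : (𝔡A x).Dd U = fun μ => coordOpK (trBasis N) (fun _ => cdBₗ x.toKIdx U μ)`) and the perturbation letters pinned
(`hTpico12 ∕ hT2co12` to `TpicoK ∕ T2coK`).  §1: at `cfg U₁ = 1` the composite `Dd U₁ ν ∘ G₀(U₁) ∘ Q*(U₁)` is the mixed coordinate model of the
flat family `∇_ν ∘ G ∘ Q*♭` (`G = Δ_a⁻¹`, r03's `Gop`), so `Letters313DM.dgQsd ν` at `U ↦ 1` IS [4] Prop. 2.6 (2.136)₁ in direction `ν` (N03's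
theorem of record, via dag-n06-h's `hasMajorant_Gop_kIdx`) read through dag-n06-d's functor and re-blocked through `Q*♭` by dag-n06-h's
`hasMajorantHom_comp_qsK_bI` — the single-direction twin of dag-n06-h's `hasMaj_D_G0_Qstar_one` (which reads the all-directions letter `DcoK`);
★★★ `letters313DM_dgQsd_one_kIdx` packages it uniformly on the census.  §2: `Letters313IMB.tDv` asks a majorant for
`(Δ′_π + Δ⁽²⁾_π)(U) ∘ (G₀(U) ∘ D_v(U))`; at `U ↦ 1` both perturbation letters vanish at the pins (dag-n06-h `tpicoK_eq_zero_of_cfg_one ∕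
t2coK_eq_zero_of_cfg_one`), so the body holds for EVERY input class and every non-negative constant — DEGENERATE BY NATURE, recorded as such.

HONEST SCOPE.  A READING ∕ bookkeeping file at `U = 1`: analytic input N03's Prop. 2.6 and p21's Lemma 2.1 (tree theorems, cited by name); pins ∕
carriers ∕ functor dag-n06-d's, letters node00-def-Y's, schemas dag-n06-l's; nothing of [B9] at curved `U` is asserted and no displayed
`∀U`-binder is witnessed; the remaining fields of `Letters313DM` (`dgDHd`, `pQd`) and of `Letters313IMB` are NOT touched.  COUNT-NEUTRAL; N06 is
NOT discharged; one finite lattice at a time; nothing continuum, nothing about the mass gap.  Cell `pub-ymgap` (HUMAN RULING D-0062 ∕ D-0149),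
Track A node N06 [B9], width seat `pub-ymgap-dag-n06-w3` (g0), 2026-08-27.
-/

noncomputable section

namespace Literature.MathematicalPhysics.QuantumFieldTheory.Balaban1983to89.B9Letters313AtOneDir

open B6MultiLevelTorusOperator (TDomains)
open B6Geom246MultiLevelTorus (geomT)
open B6GlobalChartV1 (PV blkV1)
open B6KLevelCensusIndexV1 (KIdx kGeo kGeoG)
open B6GradLegKLevelV1 (DV)
open B6Prop26Census2136KLevelV1 (Gop)
open B6RandomWalk (HasMajorant BlockSupp)
open B6RandomWalkHom (HasMajorantHom)
open B6Ineq2142KLevelV1 (lvl β)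
open B9Thm314GpFlatMultiLevelTorus (consts_260_261)
open B6Lemma21Repaired (Ineq261With)
open B9GeoNormsKLevelV1 (geo9K)
open B9GeoLemma21KLevelV1 (one_le_Mh)
open B9Thm39ReadingCoords (cR39 cR39_nonneg)
open B9Thm34Ext (toB6)
open B11SectG (HasMaj BlockNorm)
open B9Thm312Whole (cNorm GeoOK Ops)
open B9CoReadingCoords B9CoReadingCoordsH B9Prop26AtPinsOne B9LettersHAtOneG0
open B9PerturbationLettersAtOne (tpicoK_eq_zero_of_cfg_one t2coK_eq_zero_of_cfg_one hasMaj_zero_of_nonneg)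
open Node00 Node00.OpsYSectDCoords
open scoped Matrix

variable {d ℓ : ℕ} {hd : 1 ≤ d + 1} {hL : Odd (ℓ + 1) ∧ 1 < ℓ + 1} {b₀ b₁ : ℝ}

/-! ## §1 AT THE PINS: the direction-wise `∇_νG₀Q*` letter `Letters313DM.dgQsd` at a configuration reading `1` -/

section Dir

variable {𝔸 : Type} [NormedRing 𝔸] [NormedAlgebra ℂ 𝔸] [CompleteSpace 𝔸] [FiniteDimensional ℝ 𝔸]
variable {κ : Type} [Fintype κ]
variable (i : KIdx d ℓ hd hL b₀ b₁) (b : Module.Basis κ ℝ 𝔸) (B : B9.Backgrounds) (cfg : B.Cfg → CfgY 𝔸 i)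
  (O : BondOpY 𝔸 i) (parB : BondParY 𝔸 i)

/-- ★ **THE PINNED SINGLE-DIRECTION DERIVATIVE AFTER `G₀Q*`, AT `U = 1`, IS THE MIXED MODEL OF THE FLAT FAMILY `∇_{1,μ} ∘ G ∘ Q*♭`**: with the
certificate's pin `Dd U = fun μ => coordOpK b (fun _ => ∇_{U,μ})` and dag-n06-h's `GcoK_comp_QscoKH_one`,
`coordOpK b (fun _ => ∇_{U₁,μ}) ∘ GcoK … O U₁ ∘ QscoKH … parB U₁ = coordOpKH b (fun _ => ∇_{1,μ} ∘ O(1) ∘ Q*(1))`.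
[cite: Balaban1985BackgroundPropagators, (3.133) p.422 («∇_U H»), (3.42) p.397, Cor. 3.5 p.407, dictionary] -/
theorem coordOpK_cdB_GcoK_comp_QscoKH_one (hc : cR39 b ≠ 0) {U₁ : B.Cfg} (hU₁ : cfg U₁ = fun _ _ => 1) (μ : Fin (d + 1)) :
    coordOpK b (fun _ : Fin (d + 1) => cdBₗ i (cfg U₁) μ) ∘ₗ GcoK i b B cfg O U₁ ∘ₗ QscoKH i b B cfg parB U₁ =
      coordOpKH b (fun _ : Fin (d + 1) => cdBₗ i (fun _ _ => 1) μ ∘ₗ (O (fun _ _ => 1)).restrictScalars ℝ ∘ₗ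
        (QsY i parB (fun _ _ => 1)).restrictScalars ℝ) := by
  rw [GcoK_comp_QscoKH_one i b B cfg O parB hc hU₁, hU₁, coordOpK_comp_coordOpKH]

variable {Y W : Type}

/-- ★★ **THE LETTER `dgQsd ν` OF `Letters313DM` AT `U = 1`** — `∇_{U₁,ν} G₀(U₁) Q*(U₁) : 𝔠_Z⁽⁰⁾ → 𝔠⁽¹⁾` with the majorant `B₃·e^{−δ₃′d}`, at ANY letter
record `𝔬` over the index-bond geometry whose `G0 ∕ Qstar` at a configuration `U₁` reading `1` are pinned to node00-def-Y's models `GcoK … O ∕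
QscoKH … parB` (the certificate's `hG0co12 ∕ hQsco12`, block maps `hblk12 ∕ hblkZ12`, `bI` level- and 1-faithful) and whose direction-indexed
derivative is pinned to the constant family of ONE covariant derivative (the certificate's `h𝔡Ad`): from the (2.136)₁ torus majorant of `∇_νG`,
`G = Δ_a⁻¹`, and (2.61).  Constants: `B₃ = C·c·e^{¾δ(ℓ+4)}`, `δ₃′ = ¾δ` — the same as dag-n06-h's all-directions `hasMaj_D_G0_Qstar_one`.
[cite: Balaban1985BackgroundPropagators, Thm 3.13 p.426, (3.133) p.422, Thm 3.3 p.399, (3.42) p.397, p.398 (remark after (3.47)), Cor. 3.5 p.407; Balaban1984PropagatorsII, Prop. 2.6 (2.136) p.247, Lemma 2.1 (2.61) p.234] -/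
theorem hasMaj_Dd_G0_Qstar_one (hG : GeoOK (geo9K i)) [Fintype (geo9K i).Site] [Fintype Y] [Fintype W]
    (hc : cR39 b ≠ 0) (hparB : ∀ s s', parB (fun _ _ => 1) s s' = 1)
    (hO : ∀ (J : FBondY i → ℝ) (E : 𝔸), O (fun _ _ => 1) (liftY J E) = liftY (Gop i J) E) {U₁ : B.Cfg} (hU₁ : cfg U₁ = fun _ _ => 1)
    {bI : FBondY i → IBondY i} (hlev : ∀ f : FBondY i, lvl i.hN i.D i.hk (bI f) = (blkV1 i.hN i.D f).1.1)
    (hβ1 : ∀ f : FBondY i, (geomT i.D).dist (β i.hN i.D i.hk (bI f)) (blkV1 i.hN i.D f) ≤ 1)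
    (𝔬 : Ops (geo9K i) B (XBK κ i) Y (XHK κ i) W) (hblk : 𝔬.blk = blkBK i bI) (hblkZ : 𝔬.blkZ = blkHK i)
    (hG0 : 𝔬.G0 U₁ = GcoK i b B cfg O U₁) (hQs : 𝔬.Qstar U₁ = QscoKH i b B cfg parB U₁)
    (Dd : B.Cfg → Fin (d + 1) → Module.End ℝ (XBK κ i → ℝ))
    (hDd : Dd U₁ = fun μ => coordOpK b (fun _ : Fin (d + 1) => cdBₗ i (cfg U₁) μ))
    {C δ c : ℝ} (hC : 0 ≤ C) (hδ : 0 ≤ δ) (hc0 : 0 ≤ c)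
    (hT : ∀ ν : Fin (d + 1), HasMajorant (g := geomT i.D) (blkV1 i.hN i.D) (DV ν i.cf ∘ₗ Gop i)
      (fun y y' => C * |i.cf|⁻¹ ^ 1 * ((ℓ : ℝ) + 1) ^ (1 * y.1.1) * Real.exp (-(δ * (geomT i.D).dist y y'))))
    (h261 : Ineq261With c (geomT i.D) δ (1 / 4)) (ν : Fin (d + 1)) {R₀ : ℝ} {H₀ : Prop} :
    HasMaj (cNorm R₀ H₀ 𝔬.blkZ hG.lenle 0) (cNorm R₀ H₀ 𝔬.blk hG.lenle 1) (Dd U₁ ν ∘ₗ 𝔬.G0 U₁ ∘ₗ 𝔬.Qstar U₁)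
      (fun a a' => C * c * Real.exp (3 / 4 * δ * ((ℓ : ℝ) + 4)) * Real.exp (-(3 / 4 * δ * (geo9K i).dist a a'))) := by
  rw [hblk, hblkZ, hG0, hQs, hDd]
  beta_reduce
  rw [coordOpK_cdB_GcoK_comp_QscoKH_one i b B cfg O parB hc hU₁ ν]
  refine hasMaj_cNorm_of_hasMajorantHom_pow hG (by positivity) 1 ?_
  exact hasMajorantHom_coordOpKH_of_liftY b (G := toB6 (geo9K i) R₀ H₀) (blk' := fun a : IBondY i => a) (blk := bI)
    (T := fun _ : Fin (d + 1) => (DV ν i.cf ∘ₗ Gop i) ∘ₗ Matrix.toLin' (qsK i)) (fun _ ω E => cdB_O_QsY_one_liftY i O parB hparB hO ν ω E)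
    fun _ => hasMajorantHom_comp_qsK_bI i hlev hβ1 hC hδ 1 (hT ν) h261 R₀ H₀

end Dir

/-! ## §2 AT THE PINS: the perturbation letter `Letters313IMB.tDv` at a configuration reading `1` — degenerate (`Δ′_π(1) = Δ⁽²⁾_π(1) = 0`) -/

section Degenerate

variable {𝔸 : Type} [NormedRing 𝔸] [NormedAlgebra ℂ 𝔸] [CompleteSpace 𝔸] [FiniteDimensional ℝ 𝔸]
variable {κ : Type} [Fintype κ]
variable (i : KIdx d ℓ hd hL b₀ b₁) (b : Module.Basis κ ℝ 𝔸) (B : B9.Backgrounds) (cfg : B.Cfg → CfgY 𝔸 i)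
  (parS : SiteParY 𝔸 i) (Gp : SiteOpY 𝔸 i)
variable {g : B9.Geometry} [Fintype g.Site] {Y Z W : Type}

omit [Fintype g.Site] in
/-- **`(Δ′_π + Δ⁽²⁾_π)(U₁) ∘ T = 0` AT THE PINS WHEN `cfg U₁ = 1`**, for every right factor `T` (the certificate's `hTpico12 ∕ hT2co12`, a residual letter
with `Δ⁽²⁾(1) = 0`). [cite: Balaban1985BackgroundPropagators, (3.120)–(3.121) pp.419–420, (3.134)–(3.135) p.422, Cor. 3.5 p.407] -/
theorem Tpi_add_T2_comp_eq_zero_of_pins_one (𝔬 : Ops g B (XBK κ i) Y Z W) {Δ2 : BondOpY 𝔸 i} (hΔ : Δ2 (fun _ _ => 1) = 0)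
    {U₁ : B.Cfg} (hU₁ : cfg U₁ = fun _ _ => 1) (hTpi : 𝔬.Tpi U₁ = TpicoK i b B cfg parS Gp U₁)
    (hT2 : 𝔬.T2 U₁ = T2coK i b B cfg parS Gp Δ2 U₁) {V : Type} (T : (V → ℝ) →ₗ[ℝ] (XBK κ i → ℝ)) :
    (𝔬.Tpi U₁ + 𝔬.T2 U₁) ∘ₗ T = 0 := by
  rw [hTpi, hT2, tpicoK_eq_zero_of_cfg_one i b B cfg parS Gp hU₁, t2coK_eq_zero_of_cfg_one i b B cfg parS Gp hΔ hU₁, add_zero,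
    LinearMap.zero_comp]

/-- ★ **THE LETTER `tDv` OF `Letters313IMB` AT `U = 1`, DEGENERATE**: at a letter record whose `Tpi ∕ T2` at a configuration `U₁` reading `1` are pinned
to node00-def-Y's `TpicoK ∕ T2coK` (residual letter with `Δ⁽²⁾(1) = 0`), the operator `(Δ′_π + Δ⁽²⁾_π)(U₁) ∘ (G₀(U₁) ∘ D_v(U₁))` is ZERO, so it has
every non-negative majorant between EVERY pair of classes — in particular the displayed `HasMaj (bHW ε) (𝔠⁽¹⁾) … (θ_v(ε)·e^{−δ_K d})` for every input
class `bHW ε` and every `θ_v(ε) ≥ 0`.  DEGENERATE BY NATURE: it witnesses nothing about `θ_v` at curved `U`.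
[cite: Balaban1985BackgroundPropagators, Thm 3.13 p.426, (3.130)–(3.131) pp.421–422, (3.120)–(3.121) pp.419–420, (3.135) p.422, Cor. 3.5 p.407] -/
theorem tDv_of_pins_one (𝔬 : Ops g B (XBK κ i) Y Z W) {Δ2 : BondOpY 𝔸 i} (hΔ : Δ2 (fun _ _ => 1) = 0)
    {U₁ : B.Cfg} (hU₁ : cfg U₁ = fun _ _ => 1) (hTpi : 𝔬.Tpi U₁ = TpicoK i b B cfg parS Gp U₁)
    (hT2 : 𝔬.T2 U₁ = T2coK i b B cfg parS Gp Δ2 U₁) {R₀ : ℝ} {H₀ : Prop} (bW : BlockNorm (toB6 g R₀ H₀) (W → ℝ))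
    (bX : BlockNorm (toB6 g R₀ H₀) (XBK κ i → ℝ)) {θ δK : ℝ} (hθ : 0 ≤ θ) :
    HasMaj bW bX ((𝔬.Tpi U₁ + 𝔬.T2 U₁) ∘ₗ (𝔬.G0 U₁ ∘ₗ 𝔬.Dv U₁)) (fun a a' => θ * Real.exp (-(δK * g.dist a a'))) := by
  rw [Tpi_add_T2_comp_eq_zero_of_pins_one i b B cfg parS Gp 𝔬 hΔ hU₁ hTpi hT2]
  exact hasMaj_zero_of_nonneg _ _ fun a a' => mul_nonneg hθ (Real.exp_nonneg _)

end Degenerate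

/-! ## §3 UNIFORMLY ON THE CENSUS: the direction-wise letter with one threshold, one constant, one rate (N03's constants) -/

section Record

variable {𝔸 : Type} [NormedRing 𝔸] [NormedAlgebra ℂ 𝔸] [CompleteSpace 𝔸] [FiniteDimensional ℝ 𝔸]
variable {κ : Type} [Fintype κ]

/-- ★★★ **THE DIRECTION-WISE `∇_νG₀Q*`-LETTER OF `Letters313DM` (`dgQsd`) AT `U = 1`, UNIFORMLY ON THE k-LEVEL CENSUS** — one more `U = 1` inhabitant
of the N06 certificate's displayed `hlettersD13` body: for the band `0 < b₀ ≤ b₁` there are `M₁, B₃, δ₃ > 0` such that for every index `i` with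
`M ≥ M₁`, every letter record `𝔬` over `geo9K i` with carriers `XBK ∕ Y ∕ XHK ∕ W` pinned at a configuration `U₁` reading `1` to `GcoK … O ∕
QscoKH … parB` (`O(1)(J ⊗ E) = (GJ) ⊗ E`, transporters trivial at `1`, `cR39 b ≠ 0`), block maps `blkBK bI ∕ · ∕ blkHK` (`bI` level- and 1-faithful),
and every direction-indexed derivative `Dd` pinned at `U₁` to the constant families of the covariant derivatives:
`Dd U₁ ν ∘ G₀(U₁) ∘ Q*(U₁) : 𝔠_Z⁽⁰⁾ → 𝔠⁽¹⁾` with the majorant `B₃·e^{−δ₃d}` for every direction `ν`.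
[cite: Balaban1985BackgroundPropagators, Thm 3.13 p.426, (3.133) p.422, Thm 3.3 p.399, (3.42) p.397, Cor. 3.5 p.407; Balaban1984PropagatorsII, Prop. 2.6 (2.136) p.247, Lemma 2.1 (2.60)–(2.61) p.234] -/
theorem letters313DM_dgQsd_one_kIdx (hb₀ : 0 < b₀) (hb₁ : b₀ ≤ b₁) : ∃ M₁ B₃ δ₃ : ℝ, 0 < M₁ ∧ 0 < B₃ ∧ 0 < δ₃ ∧
    ∀ i : KIdx d ℓ hd hL b₀ b₁, M₁ ≤ (geo9K i).M → ∀ (hG : GeoOK (geo9K i)) [Fintype (geo9K i).Site] {Y W : Type} [Fintype Y] [Fintype W]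
      (b : Module.Basis κ ℝ 𝔸), cR39 b ≠ 0 → ∀ (B : B9.Backgrounds) (cfg : B.Cfg → CfgY 𝔸 i) (O : BondOpY 𝔸 i) (parB : BondParY 𝔸 i),
      (∀ s s', parB (fun _ _ => 1) s s' = 1) → (∀ (J : FBondY i → ℝ) (E : 𝔸), O (fun _ _ => 1) (liftY J E) = liftY (Gop i J) E) →
      ∀ {U₁ : B.Cfg}, cfg U₁ = (fun _ _ => 1) → ∀ {bI : FBondY i → IBondY i},
      (∀ f : FBondY i, lvl i.hN i.D i.hk (bI f) = (blkV1 i.hN i.D f).1.1) →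
      (∀ f : FBondY i, (geomT i.D).dist (β i.hN i.D i.hk (bI f)) (blkV1 i.hN i.D f) ≤ 1) →
      ∀ (𝔬 : Ops (geo9K i) B (XBK κ i) Y (XHK κ i) W),
      𝔬.blk = blkBK i bI → 𝔬.blkZ = blkHK i → 𝔬.G0 U₁ = GcoK i b B cfg O U₁ → 𝔬.Qstar U₁ = QscoKH i b B cfg parB U₁ →
      ∀ (Dd : B.Cfg → Fin (d + 1) → Module.End ℝ (XBK κ i → ℝ)),
      (Dd U₁ = fun μ => coordOpK b (fun _ : Fin (d + 1) => cdBₗ i (cfg U₁) μ)) →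
      ∀ (ν : Fin (d + 1)) {R₀ : ℝ} {H₀ : Prop},
        HasMaj (cNorm R₀ H₀ 𝔬.blkZ hG.lenle 0) (cNorm R₀ H₀ 𝔬.blk hG.lenle 1) (Dd U₁ ν ∘ₗ 𝔬.G0 U₁ ∘ₗ 𝔬.Qstar U₁)
          (fun a a' => B₃ * Real.exp (-(δ₃ * (geo9K i).dist a a'))) := by
  obtain ⟨M₁, δ₃, C, hM₁, hδ₃, hC, H⟩ := hasMajorant_Gop_kIdx (d := d) (ℓ := ℓ) (hd := hd) (hL := hL) hb₀ hb₁
  obtain ⟨N, c, -, hc0, hcon⟩ := consts_260_261 d ℓ hδ₃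
  refine ⟨max M₁ ((N : ℝ) + 1), C * (c + 1) * Real.exp (3 / 4 * δ₃ * ((ℓ : ℝ) + 4)), 3 / 4 * δ₃, lt_max_of_lt_left hM₁, by positivity,
    by positivity, ?_⟩
  intro i hM hG _ Y W _ _ b hc B cfg O parB hparB hO U₁ hU₁ bI hlev hβ1 𝔬 hblk hblkZ hG0 hQs Dd hDd ν R₀ H₀
  have hLcast : (((ℓ + 1 : ℕ) : ℝ)) = (ℓ : ℝ) + 1 := by push_cast; ring
  have hMdef : (geo9K i).M = (((ℓ + 1 : ℕ) : ℝ)) * (i.Mh : ℝ) := rfl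
  have hM₁ : M₁ ≤ (kGeoG i).M := (le_max_left _ _).trans hM
  have hN : (N : ℝ) + 1 ≤ ((ℓ : ℝ) + 1) * i.Mh := by rw [← hLcast, ← hMdef]; exact (le_max_right _ _).trans hM
  have hR1 : 1 ≤ i.R := le_trans (by omega) (toKT i).hR
  have hRN : N + 1 ≤ i.R * ((ℓ + 1) * i.Mh) := by
    have h2 : N + 1 ≤ (ℓ + 1) * i.Mh := by exact_mod_cast hN
    calc N + 1 ≤ 1 * ((ℓ + 1) * i.Mh) := by rw [one_mul]; exact h2
      _ ≤ i.R * ((ℓ + 1) * i.Mh) := Nat.mul_le_mul_right _ hR1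
  obtain ⟨-, h261⟩ := hcon i.k i.Mh i.R i.P' (one_le_Mh i) (toKT i).hP hRN
  obtain ⟨-, h1, -, -⟩ := H i hM₁
  have hA := hasMaj_Dd_G0_Qstar_one (Y := Y) (W := W) (R₀ := R₀) (H₀ := H₀) i b B cfg O parB hG hc hparB hO hU₁ hlev hβ1 𝔬 hblk hblkZ hG0 hQs
    Dd hDd hC.le hδ₃.le hc0 h1 (h261 i.D) ν
  refine hA.mono fun a a' => ?_
  gcongr
  linarith

end Record

end Literature.MathematicalPhysics.QuantumFieldTheory.Balaban1983to89.B9Letters313AtOneDir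

end
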